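import Mathlib
import HarnessLib
import HarnessLib.Audit
import Summits.Langlands.Statement
import Literature.NumberTheory.GaloisRepresentations.CubicResidueSymbol
import HarnessLib.Audit.Status.Attr

/-!
Route: PicardMuOrdinary

DORMANT since 2026-08-24T08:50:12Z (reconciler: no traction for 6.6 d (last activity item-evidence-added at 2026-08-17T16:54:02Z); parked, not closed — `ledger route dormant route-Langlands-PicardMuOrdinary --off` to reactivate) — unstaffed, not closed; items shared with open routes are served there. `ledger route dormant <id> --off` reactivates.

# Route PicardMuOrdinary — Picard curves are automorphic over Q(omega) via free S4=PGL2(F3) residual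
automorphy at the ramified prime and mu-ordinary irregular-weight lifting

X = PicardAutomorphy, "generic Picard curves over ℚ are automorphic over K = ℚ(ω)": for every f ∈
ℤ[X] of degree 4, separable,
with 12 ∣ #Gal(f) (⇔ f irreducible with Gal(f) ∈ {A₄, S₄}) and every level datum hcpt, there are a
complex embedding e of K and a
cuspidal L-algebraic automorphic representation π of GL₃(𝔸_K) whose Satake parameters at almost
every finite place 𝔭 of K sum to
e(a_𝔭(f)), where a_𝔭(f) = `Literature.NumberTheory.GaloisRepresentations.picardTrace f 𝔭` =
−Σ_{x∈𝓞_K/𝔭} χ_𝔭(f(x)) (cubic residue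
symbol; Literature, landed 2026-08-15) is the trace of geometric Frobenius on the ω-eigenpart of H¹
of the Picard curve C : y³ = f(x).
X is the family of instances of conjunct (B) `Summit.Langlands.GaloisToAutomorphic 3` over ℚ(ω) for
the λ-adic representations of
Picard Jacobians (IRREGULAR Hodge–Tate weights {0,0,1}), in the summit's a.e.-Satake, m = 1
(L-algebraic) normalisation; it realises
card picard-branch-point-residual (P1–P5). The route decides the summit through the junction item
SectorComplement (X → Langlands),
the hub convention for sector routes on this all-fields/all-ranks summit; its mathematical content
is cruxes ⟹ X (pure logic, checked).
Lean: `∀ (f : Polynomial ℤ) (hcpt :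
Literature.NumberTheory.Automorphic.isCompact_glFiniteIntegralLevel 3 (CyclotomicField 3 ℚ)),
f.natDegree = 4 → (f.map (Int.castRingHom ℚ)).Separable → 12 ∣ Nat.card (f.map (Int.castRingHom
ℚ)).Gal → ∃ (e : CyclotomicField 3 ℚ →+* ℂ) (π :
Literature.NumberTheory.Automorphic.CuspidalAutomorphicRepData 3 (CyclotomicField 3 ℚ) hcpt),
π.1.IsLAlgebraic ∧ ∀ᶠ 𝔭 : IsDedekindDomain.HeightOneSpectrum (NumberField.RingOfIntegers
(CyclotomicField 3 ℚ)) in Filter.cofinite, ∃ α : Multiset ℂ, π.1.HasSatakeParamAt 𝔭 α ∧ α.sum = e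
(Literature.NumberTheory.GaloisRepresentations.picardTrace f 𝔭)`

## Assembly
Pure logic, CHECKED (Sketch.lean rc 0, 2026-08-15; glue.lean is the deciding theorem): for generic f
the real-root count is 4
(ResidualAutomorphyEven) or not (ResidualAutomorphyOdd), giving the residual hypothesis of
MuOrdinaryFamilyRT; its conclusion is the
hypothesis of IrregularClassicality, whose conclusion is X; SectorComplement carries X to
`Langlands`:
`theorem closes (hOdd) (hEven) (hRT) (hCl) (hC : SectorComplement) : _root_.Langlands := hC (…)`
with a `by_cases` on
`(f.map (Int.castRingHom ℝ)).roots.card = 4`.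

Rationale: WHY THIS LINE. Mechanism (card picard-branch-point-residual): at the RAMIFIED prime λ = (1 − ω) of K
the residual representation J(C)[λ] is the
branch-point module 𝔽₃[roots of f]/diagonal, i.e. the reflection representation of Gal(f) ⊂ S₄ ≅
PGL₂(𝔽₃) (PoonenSchaefer1997,
Upton2009), so residual automorphy in REGULAR weight over K is free for every generic Picard curve
over ℚ: projectively odd (0 or 2
real roots) by Langlands–Tunnell + Deligne–Serre + Gelbart–Jacquet Sym² + Arthur–Clozel base change
(Langlands1980, Tunnell1981,
DeligneSerreASENS1974, GelbartJacquet1978, ArthurClozelAMS120), totally real (4 real roots) by JPSS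
non-normal cubic induction from the
CM sextic K₃(ω) of a Teichmüller-adjusted algebraic Hecke character (JPSS1981Cubique). The lifting
is the Boxer–Calegari–Gee–Pilloni
irregular-weight machine (BoxerEtAl2021, BCGP2025ModularityAbelianSurfaces: higher Hida theory, R =
T in irregular weight, Sen-theoretic
classicality) transplanted from GSp₄ to the Picard modular surface GU(2,1)_{ℚ(ω)/ℚ} — which IS the
moduli of Picard Jacobians — where
Nguyen2020HigherHidaGU21 built the Hida complex at SPLIT p expressly as "a first step towards
modularity of Picard curves", but where the
only prime with a free residual input is the ramified, never-ordinary λ (Deuring–Šafarevič: 3-rank ≤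
2; BouwEtAl2020 Prop. 30), so
the machine must run μ-ordinarily (3-rank-2 stratum, P-ordinary for the (2,1)-parabolic:
Marcil2024POrdinaryUnitary,
BijakowskiHernandez2022, BrascaRosso2021) on a ramified Pappas–Rapoport model. Imported areas:
arithmetic geometry of superelliptic
curves (branch-point torsion, cubic character sums — now the Literature file CubicResidueSymbol) and
p-adic coherent cohomology of
unitary Shimura varieties. Versus the retired gen-1 route-Langlands-PicardBranchPoint (operator
close not-a-thesis, D-0027 §2.1; its
refuter reviews found all 7 decls rc 0 and the trace convention numerically right): same spine, now
(i) DECIDED — `closes : … →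
SectorComplement → Langlands`; (ii) typed over the landed `picardTrace` (ζ-free statements); (iii)
residual branches re-cut along
projective parity (odd ⇔ fewer than 4 real roots, refuter note on stmt-Langlands-2771), shrinking
the CM-induction item to totally real
quartic fields. Negatives index: 1 entry on the summit (K3KugaSatakeDescent anchor), unrelated.

RANKED CRUXES. #0 PicardAutomorphy (target) — X above: every Picard curve y³ = f(x), f ∈ ℤ[X] a
separable quartic with Gal(f) ∈ {A₄, S₄}, is automorphic over ℚ(ω): ∃ e : K →+* ℂ and a cuspidal
L-algebraic π on GL₃(𝔸_K) with Σ(Satake at 𝔭) = e(a_𝔭(f)) for almost all 𝔭 (card P1–P5). (why it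
might fail: Open (B)-slice; as TYPED refutable only through conventions: sign/conjugation of a_𝔭 (∃
e absorbs χ ↔ χ̄; BranchPointCongruence pins the sign) and Σα = weight-1 trace of the L-algebraic π
(summit m = 1); ∀ generic f includes λ-supersingular and potentially multiplicative members with no
engine.) [Upton2009, PoonenSchaefer1997, BuzzardGeeLMS2014, BCGP2025ModularityAbelianSurfaces,
BouwEtAl2020, Nguyen2020HigherHidaGU21, DimitrovRamakrishnan2025PicardType]
#2 MuOrdinaryFamilyRT (crux) — (card P2+P3, output form: μ-ordinary higher Hida family + R^{μ-ord} =
T at the ramified prime λ) For generic f: if ρ̄_{C,λ} is residually automorphic in regular weight —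
some regular algebraic cuspidal P on GL₃(𝔸_K) and a maximal ideal 𝔐 ∋ 3 of ℤ̄ such that for almost
all 𝔭 the Hecke polynomial ∏(X − N𝔭·α_j) of P at 𝔭 has ℤ̄-coefficients and reduces mod 𝔐 to the
branch-point (reflection) characteristic polynomial of Frob_𝔭, i.e. (X−1)³, (X−1)²(X+1), X³−1,
(X−1)(X+1)², X³+X²+X+1 according as f mod 𝔭 has 4, 2, 1 roots, or 0 roots with square resp.
non-square discriminant — then ρ_C is a 3-ADIC LIMIT of regular algebraic cuspidal automorphic
representations: ∃ e, 𝔐, finite S such that for every k there is a regular algebraic cuspidal P_k,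
unramified outside S, with N𝔭·ΣSatake(P_k, 𝔭) ≡ e(a_𝔭(f)) mod 3^k ℤ̄_𝔐 for all 𝔭 ∉ S. [deps:
ResidualAutomorphyOdd, ResidualAutomorphyEven] [difficulty: open-problem] (why it might fail: HT
{0,0,1}, never ordinary at λ (3-rank ≤ 2), λ ramified, 3 ∣ #S₄ (adequacy fails formally): μ-ordinary
higher Hida on the ramified Pappas–Rapoport model, torsion Galois reps, TW patching all unbuilt; for
λ-supersingular (y³−y=x⁴) or deep wild-level members the mod-3^k congruence may be FALSE.)
[BCGP2025ModularityAbelianSurfaces, BoxerEtAl2021, Nguyen2020HigherHidaGU21,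
Marcil2024POrdinaryUnitary, BijakowskiHernandez2022, BrascaRosso2021, CalegariGeraghty2017,
Thorne2012, Geraghty2018, BouwEtAl2020, arXiv:1412.5494]
#3 IrregularClassicality (crux) — (card P4, output form: classicality in irregular weight at λ) For
generic f: if ρ_C is a 3-adic limit of regular algebraic cuspidal automorphic representations in the
sense of MuOrdinaryFamilyRT's conclusion, then C is automorphic (the target's conclusion: a cuspidal
L-algebraic π with Σ Satake = e(a_𝔭(f)) a.e.). [deps: MuOrdinaryFamilyRT] [difficulty: open-problem]
(why it might fail: BCGP prove Sen = Cousin classicality only for p split completely in the totally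
real field; other cases 'will require new ideas' (arXiv:2502.20645 p. 3). Here G = U(2,1), p = 3
ramifies in K, and the typed hypothesis keeps only trace congruences mod 3^k (no level, slope or
U(2,1)-descent at λ).) [BCGP2025ModularityAbelianSurfaces, Pilloni2020,
BoxerPilloni2021HigherColeman, GoldringKoskivirta2019, Chenevier2011, Mok2014]
#9 ResidualAutomorphyOdd (support) — (card P1, projectively ODD branch; theorem-sized on paper) For
generic f with fewer than 4 real roots (0 or 2: complex conjugation is a double transposition or a
transposition, so every lift σ̄ : G_ℚ → GL₂(𝔽̄₃) of the projective S₄/A₄ representation is odd):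
Langlands–Tunnell + Deligne–Serre give an ordinary weight-2 g ≡ σ̄; Sym² g (Gelbart–Jacquet; g
non-CM since the projective image is S₄/A₄) is cuspidal; BC_{K/ℚ}(Sym² g) ⊗ (Teichmüller twist) is
regular algebraic cuspidal on GL₃(𝔸_K) and, as Ad⁰σ̄ ≅ reflection ⊗ sgn, its Hecke polynomials
reduce mod 𝔐 to the branch-point characteristic polynomials a.e. [difficulty: L] [Langlands1980,
Tunnell1981, DeligneSerreASENS1974, GelbartJacquet1978, Gelbart1997, ArthurClozelAMS120,
Wiles1995Annals]
#9 ResidualAutomorphyEven (support) — (card P1, totally real branch; known-results assembly per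
retriage 2026-08-15, so support) For generic f with 4 real roots (splitting field and resolvent
cubic field K₃ totally real, K₃(ω) a CM sextic): there are a regular algebraic cuspidal P on
GL₃(𝔸_K) and 𝔐 ∣ 3 whose Hecke polynomials reduce mod 𝔐 to the branch-point characteristic
polynomials a.e. — intended P = AI_{K₃(ω)/K}(εψ) ⊗ twist, ε the quadratic character with
Ind_{D₈}^{S₄} ε = reflection, ψ algebraic of type (0,1,2 | 2,1,0) with trivial reduction
(Teichmüller adjustment); risks: ψ with the congruence, cuspidality and integrality of the
non-normal cubic induction, char-poly congruence via Brauer–Nesbitt; polarizability is NOT typed.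
[difficulty: L] [JPSS1981Cubique, ArthurClozelAMS120, SerreAbelianLadic1968, PoonenSchaefer1997,
Upton2009, HarrisLanTaylorThorneRMS2016]
#9 BranchPointCongruence (support) — (elementary shadow of J[1−ω] ≅ reflection module; pins the sign
convention of a_𝔭) For every ζ ∈ 𝓞_K with ζ² + ζ + 1 = 0, every f ∈ ℤ[X] and every finite 𝔭 ∤ 3 with
f ≢ 0 mod 𝔭: a_𝔭(f) ≡ #{x ∈ 𝓞_K/𝔭 : f(x) = 0} − 1 (mod 1 − ζ). Provable now in three lines from
`picardTrace_sub_card_roots_sub_one_mem_span` and `isPrimitiveRoot_of_sq_add_self_add_one` (done in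
the planner's Sketch.lean, kernel-closed). [difficulty: provable-now] [IrelandRosen1982, Upton2009,
BouwEtAl2020]
#9 SectorComplement (support) — OUT-OF-SCOPE REMAINDER = the rest of the summit: `PicardAutomorphy →
Langlands`. NOT attacked by this route and not expected to close before the summit itself; filed
only so that the deciding theorem `closes : ResidualAutomorphyOdd → ResidualAutomorphyEven →
MuOrdinaryFamilyRT → IrregularClassicality → SectorComplement → Langlands` honestly concludes the
summit constant (D-0027 §2.1; same convention as E8QuinticResidue.SectorComplement,
QuadraticWindow.BeyondTheWindow, EvenArtinGL4Door.EvenArtinJunction,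
GaloisWeightedBE.SectorComplement, CapacityClassicality.SectorToLanglands — the summit shape ∀ F ∃ 𝓡
∀ n, (A) ∧ (B) cannot follow from one sector). It contains everything the thesis does not claim:
direction (A), every (n, F) other than the Picard family over ℚ(ω), local–global compatibility at
every finite place, the data 𝓡 and the λ-adic-to-every-ℓ passage even inside the sector. Trivially
implied by `Langlands`. Refuters/graders: judge the route on MuOrdinaryFamilyRT /
IrregularClassicality and the target, not on this item; never staffed from this route. [difficulty:
open-problem] [BuzzardGeeLMS2014, BCGP2025ModularityAbelianSurfaces]

TWO-LAYER PLAN. Foreseen (nothing filed now): (1) MuOrdinaryFamilyRT ⇐ RTMuOrdinary (same statement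
under the extra hypothesis
`HasMuOrdinaryReductionAtThree f`: potentially good reduction at λ of two-branch-point type x y³ − x
y = g(x), 3-rank 2,
λ-distinguished; definition request D1) → RTSupersingular (the complement: potentially supersingular
y³ − y = x⁴ type and
not-potentially-good members; conceded by the card, kept as the honest remainder) →
MuOrdinaryFamilyRT (glue = case split) — to be
filed as soon as D1 lands, BEFORE prover time goes to rank 2 as typed (refuter objection O1 on
stmt-Langlands-2769). (2) If
ResidualAutomorphyEven stalls: HeckeCharacterExists (ψ on K₃(ω) with ψ̄ = 1, type (0,1,2|2,1,0)) →
CubicInduction (JPSS AI(εψ) is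
regular algebraic cuspidal with the right reduction) → ResidualAutomorphyEven. (3)
IrregularClassicality ⇐ OverconvergentToClassical
(μ-ordinary / small-slope members) → InfiniteSlopeRemainder → IrregularClassicality, once an
eigenvariety or higher-Coleman interface
for U(2,1) exists in Literature.

KILL CRITERIA. (1) The a_𝔭 convention is now a Literature theorem (BranchPointCongruence closes at
once); an item refuted THROUGH the convention
(sign, N𝔭·Σα vs Σα) is misstated ⇒ restate the items containing a_𝔭, not a close. (2) A
grounder/refuter shows from
BornerBouwWewers2017 / BouwEtAl2020 that potentially good reduction of two-branch-point (3-rank 2)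
type is NOT attained by a positive
proportion of S₄-quartics over ℚ ⇒ MuOrdinaryFamilyRT loses its engine for most curves ⇒ pivot to
finite slope (higher Coleman,
BoxerPilloni2021HigherColeman) or close `exhausted` with census. (3) ResidualAutomorphyEven refuted
as typed ⇒ restate the target to
roots.card ≠ 4 and drop the even item (the odd item already covers 0 or 2 real roots). (4)
MuOrdinaryFamilyRT refuted by a
λ-supersingular or wild-level witness (an automorphic Picard curve whose eigensystem is provably not
a 3-adic limit of regular
cuspidal ones at fixed tame level) ⇒ refuted-misstated: add RTMuOrdinary under D1 as the repaired
item and re-certify the glue with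
the correspondingly restricted target. (5) A published automorphy theorem for generic Picard curves
by any method (searched
2026-08-15: none; Nguyen2020HigherHidaGU21 announces the split-p programme only) ⇒ close
`superseded`/`known`. (6)
IrregularClassicality and the target are implied by reciprocity: they close only `exhausted`, never
`refuted`, unless mistyped —
refuters should attack the normalisations (N𝔭·Σα for regular algebraic P per lang.S27; Σα for
L-algebraic π per the summit's
SatakeFrobCompatibleAt).

NOT DECOMPOSED YET. Inside MuOrdinaryFamilyRT: the Pappas–Rapoport/Krämer model of the Picard
surface at 3, the μ-ordinary (3-rank-2) stratum and its
Hasse invariant at a RAMIFIED prime, the perfect higher-Hida complex in degrees [0,1] with control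
at weight (1,1,1), torsion Galois
representations valued in its Hecke algebra, Taylor–Wiles patching of complexes with image S₄/A₄ ⊂
GL₃(𝔽₃) (p = n = 3:
Thorne2012-adequacy fails formally — H¹(A₄, 𝔽₃) ≠ 0 and scalars ⊂ ad⁰ — so "adequate enough" is a
hand check as in BCGP §5), the
P-ordinary local deformation ring at λ. Inside IrregularClassicality: the Sen operator on the
perfectoid Picard surface, p-adic
Eichler–Shimura for U(2,1) at ramified p, multiplicity one for the family. ALTERNATIVE DECOMPOSITION
recorded, not filed (gen-2
observation): after a solvable CM base change L/K with L⁺_v ≅ the Galois closure of the field over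
which C acquires good reduction
at λ (CHT-type globalisation), every prime of L⁺ above 3 SPLITS in L and C has good μ-ordinary
reduction there, so ρ_C|G_{L_w} is
Borel-ordinary with crystalline diagonal characters of irregular Hodge–Tate pattern (slopes 0, ½,
1): Hida theory and R = T then
live on a unitary Shimura variety at a split prime (Nguyen2020HigherHidaGU21, Geraghty2018,
Marcil2024POrdinaryUnitary technology) at
the price of (a) classicality over an absolutely ramified L⁺_v (BCGP need p totally split in the
totally real field) and (b) solvable
descent of irregular automorphy L → K (Arthur–Clozel + GoldringKoskivirta2019 + Mok2014) — a sibling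
route if wanted, not a rival
family inside this one. Also not decomposed: the upgrade from a.e.-Satake matching to the summit's
all-places `Corresponds` and the
λ-adic ↔ ℓ-adic passage (shared by every (B)-slice; inside SectorComplement); the ladder y^ℓ = f₄ (ℓ
≥ 5, mixed signatures,
definite at some infinite places); Picard curves with Gal(f) ∈ {D₄, V₄, C₄} (residually reducible) —
excluded, not claimed.

CHEAPEST FALSIFIER. (a) Lookup, 30 min: BouwEtAl2020 Prop. 30 (arXiv:1902.09624 p. 8) lists the two
good special fibres in characteristic 3 —
y³ − y = x⁴ (one branch point, 3-rank 0, a single curve) and x y³ − x y = g(x) (two branch points,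
3-rank 2, a family); what
remains is to check in BornerBouwWewers2017 (cases (a)–(e), tables of small-conductor Picard curves)
that the 3-rank-2 type is attained
by S₄-quartics over ℚ — if not, kill criterion (2) fires before any prover time. (b) Computation, an
afternoon (`kit compute`; not run
here, planners are compute-free): for f = x⁴ + x + 1 (disc 229, S₄, two real roots) tabulate a_𝔭(f)
= picardTrace for N𝔭 < 500
(the refuter's picard_check.py on stmt-Langlands-2768 already confirms sign and normalisation at p =
7, 13, 19), locate the weight-1
octahedral form of level dividing 3^a·229 and the ordinary weight-2 g ≡ σ̄ (LMFDB), and test N𝔭·tr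
BC(Sym² g)(𝔭) ≡ a_𝔭(f) mod 𝔐 at
twenty split primes — failure refutes the reduction table of ResidualAutomorphyOdd (a typing kill),
success is the first certified rung.

NUMBERS. Genus 3; J(C) of dimension 3 with ℤ[ω]-multiplication of signature (2,1); Hodge–Tate
weights {0,0,1}/{0,1,1} per embedding
(irregular, repeated twice = limit of discrete series, weight (1,1,1) Picard modular forms in H⁰ and
H¹: Nguyen2020HigherHidaGU21 pp.
21–24); residual image S₄ (24) or A₄ (12) on 𝔽₃³, 3 ∣ 24; μ-ordinary Newton slopes at λ
(0,0,½,½,1,1), 3-rank of a good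
characteristic-3 fibre ∈ {0, 2}, never 3 (Deuring–Šafarevič); conductor exponent at 3 at least 6 in
the potentially good case
(BouwEtAl2020); BCGP 2025 need p ∈ {2, 3} totally split for classicality (arXiv:2502.20645 p. 3);
items at open: 8 (1 target, 2
cruxes, 4 support, 1 assembly).

DEFINITION REQUESTS. (D1) `HasMuOrdinaryReductionAtThree (f : Polynomial ℤ) : Prop` — y³ = f(x) has
potentially good reduction at 3 whose good model has
special fibre of two-branch-point type x y³ − x y = g(x) (3-rank 2), with Frobenius on the rank-2
unit-root part having distinct
eigenvalues (λ-distinguished); sources BouwEtAl2020 Prop. 30, BornerBouwWewers2017; topic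
Literature/AlgebraicGeometry (next to
GoodReduction); needed for the first split of MuOrdinaryFamilyRT; filed with `ledger workitem add
--kind definition` right after
open. (D2) DONE: `cubicResidueSymbol`, `picardTrace`
(Literature.NumberTheory.GaloisRepresentations.CubicResidueSymbol, landed
2026-08-15) — used by every item here. Cite facts wanted as hypotheses for the support items:
JPSS1981Cubique non-normal cubic
automorphic induction for algebraic Hecke characters (the tree's `automorphicInduction_character` is
Galois prime degree, finite order
only); the Deligne–Serre lifting lemma (DeligneSerreASENS1974 Lemme 6.11); Langlands–Tunnell
(Langlands1980, Tunnell1981);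
Gelbart–Jacquet Sym² (GelbartJacquet1978); Arthur–Clozel cyclic base change for GL₃
(ArthurClozelAMS120).

Novelty: Searches (2026-08-15, this session; lit searchd intermittently rc 75 and the OpenAlex budget
exhausted, so zbMATH + galaxy + held
texts): `lit galaxy search "Picard modular surface" --star all` (30 rows: Morel, Bajpai–Cavicchi
Eisenstein cohomology, de
Shalit–Goren theta operators, BHKRY special divisors — no lifting); `lit galaxy search "Picard
curve" --star pdf` (16: CM plane
quartics, Sutherland superelliptic point counting, Laga–Shnidman Ceresa cycles — no automorphy); `…
"Picard curves are modular"
--star pdf` (0); `… "higher Hida theory for unitary" --star pdf` (0); `lit search --source zbmath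
"Picard curve modular"` (15,
none relevant), `"higher Hida theory unitary"` (4: Marcil arXiv:2409.03783, Buzzard eigenvarieties),
`"Hasse invariants ramified
unitary"` (0), `"mu-ordinary Hasse invariant ramified unitary Shimura"` (0); `lit read`
Nguyen2020HigherHidaGU21 pp. 3–4, 21–24
(Hida complex for GU(2,1) at p SPLIT in K, "first step towards modularity of Picard curves in the
spirit of BCGP18", no residual
input, no ramified prime) and DimitrovRamakrishnan2025PicardType = arXiv:2511.04609 (uniform isogeny
bounds for Picard-type
threefolds via Bombieri–Lang on Picard surfaces — not automorphy); plus the card's and the gen-1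
route's searches of the same day
(crossref/zbMATH/galaxy; `lit frontier Langlands --since 2020`, `lit bridges Langlands --cross any`:
no Picard items) and the
refuter novelty audit aud-20 (PASS 7, kept new-combination; prior art Schaefer 1998 / Upton2009 fo  [refs: 10.70675/6b01df2dze21dz40a6zb910z23a13a2cf761:, 2409.03783, 2511.04609, doi:10.70675/6b01df2dze21dz40a6zb910z23a13a2cf761, Upton2009, BoxerEtAl2021, PoonenSchaefer1997, BijakowskiHernandez2022, BrascaRosso2021]

Barriers (technique_class: higher-hida irregular-weight automorphy-lifting): - technique_class: higher-hida irregular-weight automorphy-lifting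
- Literature.Barriers.Langlands.NonRegularWeightBarrier: met by design (HT {0,0,1}) and evaded along
its recorded evasion: COHERENT cohomology of the Picard modular surface in degrees 0 and 1
(holomorphic limit of discrete series, weight (1,1,1)) + higher Hida theory + Sen-theoretic
classicality, never Betti cohomology; nothing is claimed for the fourth form.
- Literature.Barriers.Langlands.TaylorWilesNumericalCoincidence: the irregular weight lowers the
p-adic term (scope caveat (a)); handled as in BCGP by patching length-1 higher-Hida COMPLEXES in
positive defect (Calegari–Geraghty), not single modules — the coincidence is not needed in the form
the barrier kills.
- Literature.Barriers.Langlands.TaylorWilesNumericalCoincidenceNarrow: satisfied — the deformation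
problem is polarized and totally odd over the totally real base ℚ (GU(2,1)_{ℚ(ω)/ℚ}; r^c ≅ r^∨ ⊗ ε⁻¹
from the Weil pairing and the ℤ[ω]-action); nothing is patched over a base with complex places.
- Literature.Barriers.Langlands.PatchingLocalComponentBarrier: at λ the local condition is
P-(μ-)ordinary, a single irreducible component of the local deformation ring; curves outside the
μ-ordinary λ-distinguished locus are conceded (foreseen split RTSupersingular), not claimed to be
reached by patching.
- Literature.Barriers.Langlands.ResiduallyReducibleBarrier: the residual image S₄/A₄ on 𝔽₃³ is
absolutely irreducible, so the reducible class is avoided; b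

History (route lifecycle, newest last):
- 2026-08-24T08:50:12Z · DORMANT — reconciler: no traction for 6.6 d (last activity item-evidence-added at 2026-08-17T16:54:02Z); parked, not closed — `ledger route dormant route-Langlands-Picard (operator:999:1542990)

sub-problem: Langlands · status: dormant · opened planner-plancard-Langlands-Langlands-picard-b-7dd739e6-g2-0 2026-08-15T19:03:05Z · rev 4 · ledger route-Langlands-PicardMuOrdinary
GENERATED by the gate from the ledger (D-0016/17). Provers cite these decls: `theorem foo : Summit.Langlands.Langlands.Theses.PicardMuOrdinary.<Decl> := …` in Summits/Langlands/Langlands/Theorems/<Name>.lean.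
-/

namespace Summit.Langlands.Langlands.Theses.PicardMuOrdinary

open scoped BigOperators Topology Manifold Classical MeasureTheory ProbabilityTheory Matrix InnerProductSpace ComplexConjugate ContinuousMap
open Filter Set Function TopologicalSpace MeasureTheory

attribute [summit_statement] _root_.Langlands

/-- item stmt-Langlands-13756 · target · rank 0 · open · by planner
why it might fail: Open (B)-slice of reciprocity: no theorem for generic Picard curves (Nguyen 2020 = split-p programme; re-searched 2026-08-15: none). As typed refutable only via conventions — sign of a_𝔭 (pinned by proved BranchPointCongruence), Σα = trace of L-algebraic π — and ∀f includes λ-supersingular members.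
sources: Upton2009, PoonenSchaefer1997, BuzzardGeeLMS2014, BCGP2025ModularityAbelianSurfaces, BouwEtAl2020, Nguyen2020HigherHidaGU21
[target] X above: every Picard curve y³ = f(x), f ∈ ℤ[X] a separable quartic with Gal(f) ∈ {A₄, S₄},
is automorphic over ℚ(ω): ∃ e : K →+* ℂ and a cuspidal L-algebraic π on GL₃(𝔸_K) with Σ(Satake at 𝔭)
= e(a_𝔭(f)) for almost all 𝔭 (card P1–P5). -/
@[route_item "route-Langlands-PicardMuOrdinary"]
def PicardAutomorphy : Prop :=
  ∀ (f : Polynomial ℤ) (hcpt : Literature.NumberTheory.Automorphic.isCompact_glFiniteIntegralLevel 3 (CyclotomicField 3 ℚ)), f.natDegree = 4 → (f.map (Int.castRingHom ℚ)).Separable → 12 ∣ Nat.card (f.map (Int.castRingHom ℚ)).Gal → ∃ (e : CyclotomicField 3 ℚ →+* ℂ) (π : Literature.NumberTheory.Automorphic.CuspidalAutomorphicRepData 3 (CyclotomicField 3 ℚ) hcpt), π.1.IsLAlgebraic ∧ ∀ᶠ 𝔭 : IsDedekindDomain.HeightOneSpectrum (NumberField.RingOfIntegers (CyclotomicField 3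 ℚ)) in Filter.cofinite, ∃ α : Multiset ℂ, π.1.HasSatakeParamAt 𝔭 α ∧ α.sum = e (Literature.NumberTheory.GaloisRepresentations.picardTrace f 𝔭)

/-- item stmt-Langlands-13757 · crux · rank 2 · open · by planner
why it might fail: HT {0,0,1}; λ=(1−ω) ramified, never ordinary; μ-ord locus not dense in ramified PR fibre (arXiv:2302.08295 Thm 1.1); no Λ-adic R=T/Hida for definite U(3) at p=n=3, ζ₃∈K in print (stubs lambdaFinite/companions/minimalFamily); S₄ heart ext-adequate (tree), A₄ not; λ-supersingular f may fail mod 3^k.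
sources: BCGP2025ModularityAbelianSurfaces, BoxerEtAl2021, Nguyen2020HigherHidaGU21, Hernandez2017, BijakowskiHernandez2023AR, Thorne2017TwoAdic
[crux] (card P2+P3, output form: μ-ordinary higher Hida family + R^{μ-ord} = T at the ramified prime
λ) For generic f: if ρ̄_{C,λ} is residually automorphic in regular weight — some regular algebraic
cuspidal P on GL₃(𝔸_K) and a maximal ideal 𝔐 ∋ 3 of ℤ̄ such that for almost all 𝔭 the Hecke
polynomial ∏(X − N𝔭·α_j) of P at 𝔭 has ℤ̄-coefficients and reduces mod 𝔐 to the branch-point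
(reflection) characteristic polynomial of Frob_𝔭, i.e. (X−1)³, (X−1)²(X+1), X³−1, (X−1)(X+1)²,
X³+X²+X+1 according as f mod 𝔭 has 4, 2, 1 roots, or 0 roots with square resp. non-square
discriminant — then ρ_C is a 3-ADIC LIMIT of regular algebraic cuspidal automorphic representations:
∃ e, 𝔐, finite S such that for every k there is a regular algebraic cuspidal P_k, unramified outside
S, with N𝔭·ΣSatake(P_k, 𝔭) ≡ e(a_𝔭(f)) mod 3^k ℤ̄_𝔐 for all 𝔭 ∉ S. [deps: ResidualAutomorphyOdd,
ResidualAutomorphyEven] [difficulty: open-problem] -/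
@[route_item "route-Langlands-PicardMuOrdinary", crux]
def MuOrdinaryFamilyRT : Prop :=
  ∀ (f : Polynomial ℤ) (hcpt : Literature.NumberTheory.Automorphic.isCompact_glFiniteIntegralLevel 3 (CyclotomicField 3 ℚ)), f.natDegree = 4 → (f.map (Int.castRingHom ℚ)).Separable → 12 ∣ Nat.card (f.map (Int.castRingHom ℚ)).Gal → (∃ (P : Literature.NumberTheory.Automorphic.CuspidalAutomorphicRepData 3 (CyclotomicField 3 ℚ) hcpt) (𝔐 : Ideal (integralClosure ℤ ℂ)), P.1.IsRegularAlgebraic ∧ 𝔐.IsMaximal ∧ (3 : (integralClosure ℤ ℂ)) ∈ 𝔐 ∧ ∀ᶠ 𝔭 : IsDedekindDomain.HeightOneSpectrum (NumberField.RingOfIntegers (CyclotomicField 3 ℚ)) in Filter.cofinite, ∃ (α : Multiset ℂ) (Q : Polynomial (integralClosure ℤ ℂ)), P.1.HasSatakeParamAt 𝔭 α ∧ Q.map (algebraMap (integralClosure ℤ ℂ) ℂ) = (α.map (fun a => Polynomial.X - Polynomial.C ((𝔭.residueCard : ℂ) * a))).prod ∧ Q.map (Ideal.Quotient.mk 𝔐)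 = (if (f.map ((Ideal.Quotient.mk 𝔭.asIdeal).comp (algebraMap ℤ (NumberField.RingOfIntegers (CyclotomicField 3 ℚ))))).roots.toFinset.card = 4 then (Polynomial.X - 1) ^ 3 else if (f.map ((Ideal.Quotient.mk 𝔭.asIdeal).comp (algebraMap ℤ (NumberField.RingOfIntegers (CyclotomicField 3 ℚ))))).roots.toFinset.card = 2 then (Polynomial.X - 1) ^ 2 * (Polynomial.X + 1) else if (f.map ((Ideal.Quotient.mk 𝔭.asIdeal).comp (algebraMap ℤ (NumberField.RingOfIntegers (CyclotomicField 3 ℚ))))).roots.toFinset.card = 1 then Polynomial.X ^ 3 - 1 else if (∃ y : ((NumberField.RingOfIntegers (CyclotomicField 3 ℚ)) ⧸ 𝔭.asIdeal), y ^ 2 = (f.map ((Ideal.Quotient.mk 𝔭.asIdeal).comp (algebraMap ℤ (NumberField.RingOfIntegers (CyclotomicField 3 ℚ))))).discr) then (Polynomial.X - 1) * (Polynomial.X + 1) ^ 2 else Polynomial.X ^ 3 + Polynomial.X ^ 2 + Polynomial.X + 1 : Polynomial ℤ).map (Int.castRingHom ((integralClosure ℤ ℂ) ⧸ 𝔐)))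 → ∃ (e : CyclotomicField 3 ℚ →+* ℂ) (𝔐 : Ideal (integralClosure ℤ ℂ)) (S : Finset (IsDedekindDomain.HeightOneSpectrum (NumberField.RingOfIntegers (CyclotomicField 3 ℚ)))), 𝔐.IsMaximal ∧ (3 : (integralClosure ℤ ℂ)) ∈ 𝔐 ∧ ∀ k : ℕ, ∃ P : Literature.NumberTheory.Automorphic.CuspidalAutomorphicRepData 3 (CyclotomicField 3 ℚ) hcpt, P.1.IsRegularAlgebraic ∧ ∀ 𝔭 ∉ S, ∃ (α : Multiset ℂ) (t u : (integralClosure ℤ ℂ)), P.1.HasSatakeParamAt 𝔭 α ∧ (t : ℂ) = (𝔭.residueCard : ℂ) * α.sum - e (Literature.NumberTheory.GaloisRepresentations.picardTrace f 𝔭) ∧ u ∉ 𝔐 ∧ u * t ∈ Ideal.span {(3 : (integralClosure ℤ ℂ)) ^ k}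

/-- item stmt-Langlands-13758 · crux · rank 3 · open · by planner
why it might fail: Only known irregular-weight classicality: BCGP2025 Sen=Cousin for ORDINARY forms, p totally split ('new ideas' beyond: arXiv:2502.20645 p.3). Here U(2,1), p=3 ramified, λ-local rep μ-ordinary (slopes 0,½,1) not ordinary, weight (1,1,1) singular; typed input = trace limit at fixed tame level.
sources: BCGP2025ModularityAbelianSurfaces, Pilloni2020, BoxerPilloni2021HigherColeman, Hernandez2017, GoldringKoskivirta2019, Chenevier2011
[crux] (card P4, output form: classicality in irregular weight at λ) For generic f: if ρ_C is a
3-adic limit of regular algebraic cuspidal automorphic representations in the sense of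
MuOrdinaryFamilyRT's conclusion, then C is automorphic (the target's conclusion: a cuspidal
L-algebraic π with Σ Satake = e(a_𝔭(f)) a.e.). [deps: MuOrdinaryFamilyRT] [difficulty: open-problem] -/
@[route_item "route-Langlands-PicardMuOrdinary", crux]
def IrregularClassicality : Prop :=
  ∀ (f : Polynomial ℤ) (hcpt : Literature.NumberTheory.Automorphic.isCompact_glFiniteIntegralLevel 3 (CyclotomicField 3 ℚ)), f.natDegree = 4 → (f.map (Int.castRingHom ℚ)).Separable → 12 ∣ Nat.card (f.map (Int.castRingHom ℚ)).Gal → (∃ (e : CyclotomicField 3 ℚ →+* ℂ) (𝔐 : Ideal (integralClosure ℤ ℂ)) (S : Finset (IsDedekindDomain.HeightOneSpectrum (NumberField.RingOfIntegers (CyclotomicField 3 ℚ)))), 𝔐.IsMaximal ∧ (3 : (integralClosure ℤ ℂ)) ∈ 𝔐 ∧ ∀ k : ℕ, ∃ P : Literature.NumberTheory.Automorphic.CuspidalAutomorphicRepData 3 (CyclotomicField 3 ℚ) hcpt, P.1.IsRegularAlgebraic ∧ ∀ 𝔭 ∉ S, ∃ (α : Multiset ℂ) (t u : (integralClosure ℤ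 ℂ)), P.1.HasSatakeParamAt 𝔭 α ∧ (t : ℂ) = (𝔭.residueCard : ℂ) * α.sum - e (Literature.NumberTheory.GaloisRepresentations.picardTrace f 𝔭) ∧ u ∉ 𝔐 ∧ u * t ∈ Ideal.span {(3 : (integralClosure ℤ ℂ)) ^ k}) → ∃ (e : CyclotomicField 3 ℚ →+* ℂ) (π : Literature.NumberTheory.Automorphic.CuspidalAutomorphicRepData 3 (CyclotomicField 3 ℚ) hcpt), π.1.IsLAlgebraic ∧ ∀ᶠ 𝔭 : IsDedekindDomain.HeightOneSpectrum (NumberField.RingOfIntegers (CyclotomicField 3 ℚ)) in Filter.cofinite, ∃ α : Multiset ℂ, π.1.HasSatakeParamAt 𝔭 α ∧ α.sum = e (Literature.NumberTheory.GaloisRepresentations.picardTrace f 𝔭)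

/-- item stmt-Langlands-13759 · support · rank 9 · open · by planner
sources: Langlands1980, Tunnell1981, DeligneSerreASENS1974, GelbartJacquet1978, Gelbart1997, ArthurClozelAMS120
[support] (card P1, projectively ODD branch; theorem-sized on paper) For generic f with fewer than 4
real roots (0 or 2: complex conjugation is a double transposition or a transposition, so every lift
σ̄ : G_ℚ → GL₂(𝔽̄₃) of the projective S₄/A₄ representation is odd): Langlands–Tunnell +
Deligne–Serre give an ordinary weight-2 g ≡ σ̄; Sym² g (Gelbart–Jacquet; g non-CM since the
projective image is S₄/A₄) is cuspidal; BC_{K/ℚ}(Sym² g) ⊗ (Teichmüller twist) is regular algebraic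
cuspidal on GL₃(𝔸_K) and, as Ad⁰σ̄ ≅ reflection ⊗ sgn, its Hecke polynomials reduce mod 𝔐 to the
branch-point characteristic polynomials a.e. [difficulty: L] -/
@[route_item "route-Langlands-PicardMuOrdinary", crux]
def ResidualAutomorphyOdd : Prop :=
  ∀ (f : Polynomial ℤ) (hcpt : Literature.NumberTheory.Automorphic.isCompact_glFiniteIntegralLevel 3 (CyclotomicField 3 ℚ)), f.natDegree = 4 → (f.map (Int.castRingHom ℚ)).Separable → 12 ∣ Nat.card (f.map (Int.castRingHom ℚ)).Gal → (f.map (Int.castRingHom ℝ)).roots.card ≠ 4 → ∃ (P : Literature.NumberTheory.Automorphic.CuspidalAutomorphicRepData 3 (CyclotomicField 3 ℚ) hcpt) (𝔐 : Ideal (integralClosure ℤ ℂ)), P.1.IsRegularAlgebraic ∧ 𝔐.IsMaximal ∧ (3 : (integralClosure ℤ ℂ)) ∈ 𝔐 ∧ ∀ᶠ 𝔭 : IsDedekindDomain.HeightOneSpectrum (NumberField.RingOfIntegers (CyclotomicField 3 ℚ)) in Filter.cofinite, ∃ (α : Multiset ℂ) (Q : Polynomial (integralClosure ℤ ℂ)),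 P.1.HasSatakeParamAt 𝔭 α ∧ Q.map (algebraMap (integralClosure ℤ ℂ) ℂ) = (α.map (fun a => Polynomial.X - Polynomial.C ((𝔭.residueCard : ℂ) * a))).prod ∧ Q.map (Ideal.Quotient.mk 𝔐) = (if (f.map ((Ideal.Quotient.mk 𝔭.asIdeal).comp (algebraMap ℤ (NumberField.RingOfIntegers (CyclotomicField 3 ℚ))))).roots.toFinset.card = 4 then (Polynomial.X - 1) ^ 3 else if (f.map ((Ideal.Quotient.mk 𝔭.asIdeal).comp (algebraMap ℤ (NumberField.RingOfIntegers (CyclotomicField 3 ℚ))))).roots.toFinset.card = 2 then (Polynomial.X - 1) ^ 2 * (Polynomial.X + 1) else if (f.map ((Ideal.Quotient.mk 𝔭.asIdeal).comp (algebraMap ℤ (NumberField.RingOfIntegers (CyclotomicField 3 ℚ))))).roots.toFinset.card = 1 then Polynomial.X ^ 3 - 1 else if (∃ y : ((NumberField.RingOfIntegers (CyclotomicField 3 ℚ)) ⧸ 𝔭.asIdeal), y ^ 2 = (f.map ((Ideal.Quotient.mk 𝔭.asIdeal).comp (algebraMap ℤ (NumberField.RingOfIntegers (CyclotomicField 3 ℚ))))).discr)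 then (Polynomial.X - 1) * (Polynomial.X + 1) ^ 2 else Polynomial.X ^ 3 + Polynomial.X ^ 2 + Polynomial.X + 1 : Polynomial ℤ).map (Int.castRingHom ((integralClosure ℤ ℂ) ⧸ 𝔐))

/-- item stmt-Langlands-13760 · support · rank 9 · open · by planner
sources: JPSS1981Cubique, ArthurClozelAMS120, SerreAbelianLadic1968, PoonenSchaefer1997, Upton2009, HarrisLanTaylorThorneRMS2016
[support] (card P1, totally real branch; known-results assembly per retriage 2026-08-15, so support)
For generic f with 4 real roots (splitting field and resolvent cubic field K₃ totally real, K₃(ω) a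
CM sextic): there are a regular algebraic cuspidal P on GL₃(𝔸_K) and 𝔐 ∣ 3 whose Hecke polynomials
reduce mod 𝔐 to the branch-point characteristic polynomials a.e. — intended P = AI_{K₃(ω)/K}(εψ) ⊗
twist, ε the quadratic character with Ind_{D₈}^{S₄} ε = reflection, ψ algebraic of type (0,1,2 |
2,1,0) with trivial reduction (Teichmüller adjustment); risks: ψ with the congruence, cuspidality
and integrality of the non-normal cubic induction, char-poly congruence via Brauer–Nesbitt;
polarizability is NOT typed. [difficulty: L] -/
@[route_item "route-Langlands-PicardMuOrdinary", crux]
def ResidualAutomorphyEven : Prop :=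
  ∀ (f : Polynomial ℤ) (hcpt : Literature.NumberTheory.Automorphic.isCompact_glFiniteIntegralLevel 3 (CyclotomicField 3 ℚ)), f.natDegree = 4 → (f.map (Int.castRingHom ℚ)).Separable → 12 ∣ Nat.card (f.map (Int.castRingHom ℚ)).Gal → (f.map (Int.castRingHom ℝ)).roots.card = 4 → ∃ (P : Literature.NumberTheory.Automorphic.CuspidalAutomorphicRepData 3 (CyclotomicField 3 ℚ) hcpt) (𝔐 : Ideal (integralClosure ℤ ℂ)), P.1.IsRegularAlgebraic ∧ 𝔐.IsMaximal ∧ (3 : (integralClosure ℤ ℂ)) ∈ 𝔐 ∧ ∀ᶠ 𝔭 : IsDedekindDomain.HeightOneSpectrum (NumberField.RingOfIntegers (CyclotomicField 3 ℚ)) in Filter.cofinite, ∃ (α : Multiset ℂ) (Q : Polynomial (integralClosure ℤ ℂ)), P.1.HasSatakeParamAt 𝔭 α ∧ Q.map (algebraMap (integralClosure ℤ ℂ) ℂ) = (α.map (fun a => Polynomial.X - Polynomial.C ((𝔭.residueCard : ℂ) * a))).prod ∧ Q.map (Ideal.Quotient.mk 𝔐) = (if (f.map ((Ideal.Quotient.mk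 𝔭.asIdeal).comp (algebraMap ℤ (NumberField.RingOfIntegers (CyclotomicField 3 ℚ))))).roots.toFinset.card = 4 then (Polynomial.X - 1) ^ 3 else if (f.map ((Ideal.Quotient.mk 𝔭.asIdeal).comp (algebraMap ℤ (NumberField.RingOfIntegers (CyclotomicField 3 ℚ))))).roots.toFinset.card = 2 then (Polynomial.X - 1) ^ 2 * (Polynomial.X + 1) else if (f.map ((Ideal.Quotient.mk 𝔭.asIdeal).comp (algebraMap ℤ (NumberField.RingOfIntegers (CyclotomicField 3 ℚ))))).roots.toFinset.card = 1 then Polynomial.X ^ 3 - 1 else if (∃ y : ((NumberField.RingOfIntegers (CyclotomicField 3 ℚ)) ⧸ 𝔭.asIdeal), y ^ 2 = (f.map ((Ideal.Quotient.mk 𝔭.asIdeal).comp (algebraMap ℤ (NumberField.RingOfIntegers (CyclotomicField 3 ℚ))))).discr) then (Polynomial.X - 1) * (Polynomial.X + 1) ^ 2 else Polynomial.X ^ 3 + Polynomial.X ^ 2 + Polynomial.X + 1 : Polynomial ℤ).map (Int.castRingHom ((integralClosure ℤ ℂ) ⧸ 𝔐))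

/-- item stmt-Langlands-13761 · support · rank 9 · closed · proved by Summit.Langlands.Langlands.Theorems.branchPointCongruence_proof @ de3ee3809364 (prover) · by planner
sources: IrelandRosen1982, Upton2009, BouwEtAl2020
[support] (elementary shadow of J[1−ω] ≅ reflection module; pins the sign convention of a_𝔭) For
every ζ ∈ 𝓞_K with ζ² + ζ + 1 = 0, every f ∈ ℤ[X] and every finite 𝔭 ∤ 3 with f ≢ 0 mod 𝔭: a_𝔭(f) ≡
#{x ∈ 𝓞_K/𝔭 : f(x) = 0} − 1 (mod 1 − ζ). Provable now in three lines from
`picardTrace_sub_card_roots_sub_one_mem_span` and `isPrimitiveRoot_of_sq_add_self_add_one` (done in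
the planner's Sketch.lean, kernel-closed). [difficulty: provable-now] -/
@[route_item "route-Langlands-PicardMuOrdinary"]
def BranchPointCongruence : Prop :=
  ∀ (ζ : NumberField.RingOfIntegers (CyclotomicField 3 ℚ)) (f : Polynomial ℤ) (𝔭 : IsDedekindDomain.HeightOneSpectrum (NumberField.RingOfIntegers (CyclotomicField 3 ℚ))), ζ ^ 2 + ζ + 1 = 0 → (3 : NumberField.RingOfIntegers (CyclotomicField 3 ℚ)) ∉ 𝔭.asIdeal → f.map ((Ideal.Quotient.mk 𝔭.asIdeal).comp (algebraMap ℤ (NumberField.RingOfIntegers (CyclotomicField 3 ℚ)))) ≠ 0 → Literature.NumberTheory.GaloisRepresentations.picardTrace f 𝔭 - (((f.map ((Ideal.Quotient.mk 𝔭.asIdeal).comp (algebraMap ℤ (NumberField.RingOfIntegers (CyclotomicField 3 ℚ))))).roots.toFinset.card : NumberField.RingOfIntegers (CyclotomicField 3 ℚ)) - 1) ∈ Ideal.span {(1 : NumberField.RingOfIntegers (CyclotomicField 3 ℚ)) - ζ}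

/-- item stmt-Langlands-13762 · support · rank 9 · open · by planner
sources: BuzzardGeeLMS2014, BCGP2025ModularityAbelianSurfaces
[support] OUT-OF-SCOPE REMAINDER = the rest of the summit: `PicardAutomorphy → Langlands`. NOT
attacked by this route and not expected to close before the summit itself; filed only so that the
deciding theorem `closes : ResidualAutomorphyOdd → ResidualAutomorphyEven → MuOrdinaryFamilyRT →
IrregularClassicality → SectorComplement → Langlands` honestly concludes the summit constant (D-0027
§2.1; same convention as E8QuinticResidue.SectorComplement, QuadraticWindow.BeyondTheWindow,
EvenArtinGL4Door.EvenArtinJunction, GaloisWeightedBE.SectorComplement,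
CapacityClassicality.SectorToLanglands — the summit shape ∀ F ∃ 𝓡 ∀ n, (A) ∧ (B) cannot follow from
one sector). It contains everything the thesis does not claim: direction (A), every (n, F) other
than the Picard family over ℚ(ω), local–global compatibility at every finite place, the data 𝓡 and
the λ-adic-to-every-ℓ passage even inside the sector. Trivially implied by `Langlands`.
Refuters/graders: judge the route on MuOrdinaryFamilyRT / IrregularClassicality and the target, not
on this item; never staffed from this route. [difficulty: open-problem] -/
@[route_item "route-Langlands-PicardMuOrdinary", crux]
def SectorComplement : Prop :=
  PicardAutomorphy → _root_.Langlands

/-- item stmt-Langlands-13763 · assembly · rank 1 · closed · proved by Summit.Langlands.Langlands.Theorems.picardMuOrdinary_assembly_proof (prover) · by planner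
sources: BCGP2025ModularityAbelianSurfaces, BuzzardGeeLMS2014
[assembly] ResidualAutomorphyOdd → ResidualAutomorphyEven → MuOrdinaryFamilyRT →
IrregularClassicality → SectorComplement → Langlands. -/
@[route_item "route-Langlands-PicardMuOrdinary"]
def Assembly : Prop :=
  ResidualAutomorphyOdd → ResidualAutomorphyEven → MuOrdinaryFamilyRT → IrregularClassicality → SectorComplement → _root_.Langlands

/-! D-0027 §2.1 — DECIDING THEOREM (planner-authored via `route open/edit --closes-file`; by planner-plancard-Langlands-Langlands-picard-b-7dd739e6-g2-0 2026-08-15T19:03:05Z):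
its hypotheses are this route's items and its conclusion the sub-problem Statement (glue_lint), and it elaborates with this file. -/

@[closes "route-Langlands-PicardMuOrdinary"] theorem closes (hOdd : ResidualAutomorphyOdd) (hEven : ResidualAutomorphyEven)
    (hRT : MuOrdinaryFamilyRT) (hCl : IrregularClassicality) (hC : SectorComplement) :
    _root_.Langlands := by
  refine hC ?_
  intro f hcpt hdeg hsep hgal
  refine hCl f hcpt hdeg hsep hgal (hRT f hcpt hdeg hsep hgal ?_)
  by_cases h4 : (f.map (Int.castRingHom ℝ)).roots.card = 4
  · exact hEven f hcpt hdeg hsep hgal h4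
  · exact hOdd f hcpt hdeg hsep hgal h4

end Summit.Langlands.Langlands.Theses.PicardMuOrdinary
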